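import Mathlib

/-!
# Stub `stub_ndSpeaksFrequently` of line `birth`
# (crux `BridgeNodalToDWave`, item stmt-HubbardSuperconductivity-10395, route NodalDiracTwist)

Pure real arithmetic of the resonance seam of the nodal-Dirac package `ND`: for a node momentum
`κ ∈ (0, π)` with `cos κ ≠ 0` there is an `ε > 0` such that beyond every bound `L₀` there is an
EVEN torus side `L ≥ L₀` that is `ε`-non-resonant, `∀ m : ℤ, ε ≤ |L κ − m π|`.  Hence `ND` speaks
about infinitely many sides (used in `nodalOrderAlongSubsequence_of_core` of the skeleton).

Proof.  Since `cos (π/2) = 0`, `2κ ≠ π`; with `0 < 2κ < 2π` the number `2κ` keeps the distance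
`d := min (min (2κ) |2κ − π|) (2π − 2κ) > 0` from EVERY integer multiple of `π`
(`two_kappa_far_from_pi_multiples`: `n ≤ 0`, `n = 1`, `n ≥ 2`).  Put `ε := d/2`.  Given `L₀`,
either `L = 2L₀` works, or some `m` has `|2L₀ κ − m π| < d/2`; then for every `m'`,
`|(2L₀+2) κ − m' π| ≥ |2κ − (m'−m) π| − |2L₀ κ − m π| ≥ d − d/2 = ε`, so `L = 2L₀ + 2` works.

Source: elementary (the refuter's `nd_premise_infinitely_often`, 2026-08-15, re-proved).  Mathlib only,
no new definitions.  Supports the crux (`--supports stmt-HubbardSuperconductivity-10395`).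
-/

-- the mandated namespace repeats `HubbardSuperconductivity` (single-problem summit, D-0017),
-- which the `dupNamespace` linter flags on every declaration
set_option linter.dupNamespace false

namespace Summit.HubbardSuperconductivity.HubbardSuperconductivity.Theorems.NodalDiracTwist.BridgeNodalToDWave

/-- **`2κ` is uniformly far from `π ℤ`.**  For `0 < κ < π` with `cos κ ≠ 0` (so `2κ ≠ π`) there is
`d > 0` with `d ≤ |2κ − n π|` for every integer `n`: take
`d = min (min (2κ) |2κ − π|) (2π − 2κ)` and split `n ≤ 0` / `n = 1` / `n ≥ 2`. [folklore] -/
theorem two_kappa_far_from_pi_multiples {κ : ℝ} (hκ0 : 0 < κ) (hκπ : κ < Real.pi)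
    (hcos : Real.cos κ ≠ 0) :
    ∃ d : ℝ, 0 < d ∧ ∀ n : ℤ, d ≤ |2 * κ - n * Real.pi| := by
  have hne : 2 * κ - Real.pi ≠ 0 := by
    intro h
    apply hcos
    rw [show κ = Real.pi / 2 by linarith, Real.cos_pi_div_two]
  refine ⟨min (min (2 * κ) |2 * κ - Real.pi|) (2 * Real.pi - 2 * κ),
    lt_min (lt_min (by linarith) (abs_pos.mpr hne)) (by linarith), fun n => ?_⟩
  have hmin₁ : min (min (2 * κ) |2 * κ - Real.pi|) (2 * Real.pi - 2 * κ) ≤ 2 * κ :=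
    (min_le_left _ _).trans (min_le_left _ _)
  have hmin₂ : min (min (2 * κ) |2 * κ - Real.pi|) (2 * Real.pi - 2 * κ) ≤ |2 * κ - Real.pi| :=
    (min_le_left _ _).trans (min_le_right _ _)
  have hmin₃ : min (min (2 * κ) |2 * κ - Real.pi|) (2 * Real.pi - 2 * κ) ≤ 2 * Real.pi - 2 * κ :=
    min_le_right _ _
  rcases lt_trichotomy n 1 with hn | rfl | hn
  · -- `n ≤ 0`: `2κ − nπ ≥ 2κ`
    have hn' : (n : ℝ) ≤ 0 := by exact_mod_cast (show n ≤ 0 by omega)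
    have hnp : (n : ℝ) * Real.pi ≤ 0 := mul_nonpos_of_nonpos_of_nonneg hn' Real.pi_pos.le
    have hpos : 0 < 2 * κ - n * Real.pi := by linarith
    rw [abs_of_pos hpos]
    linarith
  · -- `n = 1`: `|2κ − π|`
    rw [Int.cast_one, one_mul]
    exact hmin₂
  · -- `n ≥ 2`: `nπ − 2κ ≥ 2π − 2κ`
    have hn' : (2 : ℝ) ≤ n := by exact_mod_cast (show (2 : ℤ) ≤ n by omega)
    have hnp : 2 * Real.pi ≤ (n : ℝ) * Real.pi :=
      mul_le_mul_of_nonneg_right hn' Real.pi_pos.le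
    have hnonpos : 2 * κ - n * Real.pi ≤ 0 := by linarith
    rw [abs_of_nonpos hnonpos, neg_sub]
    linarith

/-- **stub A — `NDSpeaksFrequently`.**  For a node momentum `κ ∈ (0, π)` with `cos κ ≠ 0` there is
`ε > 0` such that beyond every `L₀` some EVEN side `L ≥ L₀` is `ε`-non-resonant:
`∀ m : ℤ, ε ≤ |L κ − m π|`.  With `d` from `two_kappa_far_from_pi_multiples` and `ε = d/2`, one of
`L = 2L₀`, `L = 2L₀ + 2` works (their difference `2κ` is `d`-far from `π ℤ`). [folklore] -/
theorem stub_ndSpeaksFrequently : ∀ κ : ℝ, 0 < κ → κ < Real.pi → Real.cos κ ≠ 0 →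
    ∃ ε : ℝ, 0 < ε ∧ ∀ L₀ : ℕ, ∃ L : ℕ, L₀ ≤ L ∧ Even L ∧
      ∀ m : ℤ, ε ≤ |(L : ℝ) * κ - m * Real.pi| := by
  intro κ hκ0 hκπ hcos
  obtain ⟨d, hd, hfar⟩ := two_kappa_far_from_pi_multiples hκ0 hκπ hcos
  refine ⟨d / 2, half_pos hd, fun L₀ => ?_⟩
  by_cases h : ∀ m : ℤ, d / 2 ≤ |((2 * L₀ : ℕ) : ℝ) * κ - m * Real.pi|
  · -- the side `2L₀` is already non-resonant
    exact ⟨2 * L₀, by omega, even_two_mul L₀, h⟩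
  · -- otherwise `2L₀ κ` is `d/2`-close to some `mπ`, and then `2L₀ + 2` is non-resonant
    push Not at h
    obtain ⟨m, hm⟩ := h
    refine ⟨2 * L₀ + 2, by omega, ⟨L₀ + 1, by ring⟩, fun m' => ?_⟩
    have key := hfar (m' - m)
    have hsplit : ((2 * L₀ + 2 : ℕ) : ℝ) * κ - (m' : ℝ) * Real.pi =
        (2 * κ - ((m' - m : ℤ) : ℝ) * Real.pi) + (((2 * L₀ : ℕ) : ℝ) * κ - (m : ℝ) * Real.pi) := by
      push_cast
      ring
    rw [hsplit]
    obtain ⟨hB₁, hB₂⟩ := abs_lt.mp hm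
    rcases le_abs.mp key with hA | hA
    · exact le_abs.mpr (Or.inl (by linarith))
    · exact le_abs.mpr (Or.inr (by linarith))

end Summit.HubbardSuperconductivity.HubbardSuperconductivity.Theorems.NodalDiracTwist.BridgeNodalToDWave
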